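import Literature.Probability.LatticeModels.SRWIntersectionVariance
import HarnessLib

/-!
# Variance of the number of self-intersections of the simple random walk in a window of `ℤ⁴`:
# the `O(n)` bounds

Companion to `SRWIntersectionVariance.lean` (the reductions `varSum_le`, `ovSum_le`) and
`SRWIntersectionSums.lean` (`sum_tau_le`, `sum_nested_le`), dimension `d = 4`:

* `sum_ite_le_sum_of_injOn` — the reindexing device (an injection into a sum of nonnegative
  terms);
* `sum_pairProb_le` (`Σ_{p} P(X_p) ≤ n G`), the six share-one sums (`≤ 2n G²` each),
  the interlaced and nested sums (`≤ n K₃`, `≤ n K₄`);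
* **`ovSum_four_le`**: `ovSum 4 n ≤ (G + 12 G²) n` and **`varSum_four_le`**:
  `varSum 4 n ≤ (G + 12 G² + 2 K₃ + 2 K₄) n` — the variance of the number of self-intersections in
  a window of length `2n` of the simple random walk on `ℤ⁴` is `O(n)` (Lawler 1991, §6.4 proves
  `O(n²)` in `d = 2`; Chen 2010, §5.5).

All folklore, fully proved.
-/

noncomputable section

open MeasureTheory Finset

namespace Literature.Probability.LatticeModels

namespace SRW

/-! ### The reindexing device -/

/-- Bounding a conditional sum by a sum of nonnegative terms through an injection defined on the
terms satisfying the condition (the `ite` variant — injectivity is only required on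
`s.filter P` — of the transport lemmas `sum_le_sum_of_injOn_real` / `_nonneg` / `_of_nonneg`
already in `NumberTheory/Sieve/FriedlanderIwaniecPrimesSectorBounds.lean`,
`NumberTheory/Sieve/HeathBrownCubicNuSum.lean`, `RandomPlanarGeometry/HexSAWLowerBound.lean`).
[folklore] -/
theorem sum_ite_le_sum_of_injOn {α β : Type*} [DecidableEq β] (s : Finset α) (t : Finset β)
    (P : α → Prop) [DecidablePred P] (f : α → ℝ) (g : β → ℝ) (φ : α → β)
    (hmap : ∀ a ∈ s, P a → φ a ∈ t) (hinj : Set.InjOn φ ↑(s.filter P))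
    (hle : ∀ a ∈ s, P a → f a ≤ g (φ a)) (hg : ∀ b ∈ t, 0 ≤ g b) :
    ∑ a ∈ s, (if P a then f a else 0) ≤ ∑ b ∈ t, g b := by
  rw [← Finset.sum_filter]
  calc ∑ a ∈ s.filter P, f a ≤ ∑ a ∈ s.filter P, g (φ a) :=
        Finset.sum_le_sum fun a ha => hle a (Finset.mem_filter.1 ha).1 (Finset.mem_filter.1 ha).2
    _ = ∑ b ∈ (s.filter P).image φ, g b := (Finset.sum_image hinj).symm
    _ ≤ ∑ b ∈ t, g b := by
        refine Finset.sum_le_sum_of_subset_of_nonneg ?_ fun b hb _ => hg b hb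
        intro b hb
        rw [Finset.mem_image] at hb
        obtain ⟨a, ha, rfl⟩ := hb
        exact hmap a (Finset.mem_filter.1 ha).1 (Finset.mem_filter.1 ha).2

/-- Double sums over the upper pairs as sums over the product finset. [folklore] -/
theorem sum_sum_upperPairs (n : ℕ) (F : ℕ × ℕ → ℕ × ℕ → ℝ) :
    ∑ p ∈ upperPairs n, ∑ p' ∈ upperPairs n, F p p' = ∑ q ∈ upperPairs n ×ˢ upperPairs n, F q.1 q.2 := by
  rw [Finset.sum_product]

/-! ### One-pair sums: `Σ_{m ≥ 1} p_m(0) ≤ G` -/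

/-- `Σ_{m ∈ [1, L]} p_m(0) ≤ G - 1 ≤ G` (on `ℤ⁴`). [folklore] -/
theorem sum_Icc_prob_le (L : ℕ) : ∑ m ∈ Finset.Icc 1 L, prob 4 m 0 ≤ green4 := by
  calc ∑ m ∈ Finset.Icc 1 L, prob 4 m 0 ≤ ∑ m ∈ Finset.range (L + 1), prob 4 m 0 :=
        Finset.sum_le_sum_of_subset_of_nonneg (fun m hm => by
          rw [Finset.mem_Icc] at hm; rw [Finset.mem_range]; omega) fun m _ _ => prob_nonneg m 0
    _ ≤ green4 := green4Partial_le L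

/-- **`Σ_{p ∈ upperPairs n} P(X_p) ≤ n G`.** [folklore] -/
theorem sum_pairProb_le (n : ℕ) : ∑ p ∈ upperPairs n, pairProb 4 p ≤ n * green4 := by
  classical
  have h : ∑ p ∈ upperPairs n, pairProb 4 p =
      ∑ q ∈ Finset.range n ×ˢ Finset.range (2 * n), (if q.1 < q.2 then prob 4 (q.2 - q.1) 0 else 0) := by
    unfold upperPairs
    rw [Finset.sum_filter]
    refine Finset.sum_congr rfl fun q _ => ?_
    split_ifs with hq
    · exact pairProb_eq hq
    · rfl
  rw [h, Finset.sum_product]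
  calc ∑ i ∈ Finset.range n, ∑ j ∈ Finset.range (2 * n), (if i < j then prob 4 (j - i) 0 else 0)
      ≤ ∑ i ∈ Finset.range n, ∑ m ∈ Finset.Icc 1 (2 * n), prob 4 m 0 := by
        refine Finset.sum_le_sum fun i _ => ?_
        exact sum_ite_le_sum_of_injOn _ _ _ _ _ (fun j => j - i)
          (fun j hj hij => by rw [Finset.mem_range] at hj; rw [Finset.mem_Icc]; omega)
          (fun j hj j' hj' h => by
            simp only [Finset.coe_filter, Set.mem_setOf_eq, Finset.mem_range] at hj hj'
            simp only at h
            omega)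
          (fun j _ _ => le_rfl) fun m _ => prob_nonneg m 0
    _ ≤ ∑ _i ∈ Finset.range n, green4 := Finset.sum_le_sum fun i _ => sum_Icc_prob_le _
    _ = n * green4 := by rw [Finset.sum_const, Finset.card_range, nsmul_eq_mul]

/-! ### Share-one sums: `Σ_{i} (Σ_m p_m)(Σ_m' p_m') ≤ 2n G²` -/

/-- `Σ_{x < 2n} Σ_{m,m' ∈ [1,2n]} p_m(0) p_{m'}(0) ≤ 2n G²`. [folklore] -/
theorem sum_prod_prob_le (n : ℕ) :
    ∑ q ∈ Finset.range (2 * n) ×ˢ (Finset.Icc 1 (2 * n) ×ˢ Finset.Icc 1 (2 * n)),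
      prob 4 q.2.1 0 * prob 4 q.2.2 0 ≤ 2 * n * green4 ^ 2 := by
  rw [Finset.sum_product]
  dsimp only
  rw [Finset.sum_const, Finset.card_range, nsmul_eq_mul, Finset.sum_product]
  dsimp only
  rw [← Finset.sum_mul_sum]
  have hG := sum_Icc_prob_le (2 * n)
  have h0 : 0 ≤ ∑ m ∈ Finset.Icc 1 (2 * n), prob 4 m 0 := Finset.sum_nonneg fun m _ => prob_nonneg m 0
  push_cast
  have : (∑ m ∈ Finset.Icc 1 (2 * n), prob 4 m 0) * ∑ m ∈ Finset.Icc 1 (2 * n), prob 4 m 0 ≤ green4 ^ 2 := by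
    rw [sq]; exact mul_le_mul hG hG h0 (green4_pos).le
  nlinarith

/-- The generic share-one bound: a conditional double sum over upper pairs whose terms are
`p_m(0) p_{m'}(0)` along an injective reindexing `(p,p') ↦ (x, m, m')` is `≤ 2n G²`. [folklore] -/
theorem shareOne_le (n : ℕ) (P : ℕ × ℕ → ℕ × ℕ → Prop) [∀ p p', Decidable (P p p')]
    (x m m' : ℕ × ℕ → ℕ × ℕ → ℕ)
    (hrange : ∀ p ∈ upperPairs n, ∀ p' ∈ upperPairs n, P p p' →
      x p p' < 2 * n ∧ 1 ≤ m p p' ∧ m p p' ≤ 2 * n ∧ 1 ≤ m' p p' ∧ m' p p' ≤ 2 * n)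
    (hinj : ∀ p ∈ upperPairs n, ∀ p' ∈ upperPairs n, ∀ q ∈ upperPairs n, ∀ q' ∈ upperPairs n,
      P p p' → P q q' → x p p' = x q q' → m p p' = m q q' → m' p p' = m' q q' → p = q ∧ p' = q') :
    ∑ p ∈ upperPairs n, ∑ p' ∈ upperPairs n,
      (if P p p' then prob 4 (m p p') 0 * prob 4 (m' p p') 0 else 0) ≤ 2 * n * green4 ^ 2 := by
  classical
  rw [sum_sum_upperPairs]
  refine (sum_ite_le_sum_of_injOn _ _ (fun q : (ℕ × ℕ) × (ℕ × ℕ) => P q.1 q.2) _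
    (fun r : ℕ × (ℕ × ℕ) => prob 4 r.2.1 0 * prob 4 r.2.2 0)
    (fun q => (x q.1 q.2, (m q.1 q.2, m' q.1 q.2))) ?_ ?_ ?_ ?_).trans (sum_prod_prob_le n)
  · intro q hq hP
    rw [Finset.mem_product] at hq
    have := hrange q.1 hq.1 q.2 hq.2 hP
    simp only [Finset.mem_product, Finset.mem_range, Finset.mem_Icc]
    omega
  · intro q hq r hr h
    simp only [Finset.coe_filter, Finset.mem_product, Set.mem_setOf_eq] at hq hr
    simp only [Prod.mk.injEq] at h
    have := hinj q.1 hq.1.1 q.2 hq.1.2 r.1 hr.1.1 r.2 hr.1.2 hq.2 hr.2 h.1 h.2.1 h.2.2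
    exact Prod.ext this.1 this.2
  · intro q _ _; exact le_rfl
  · intro r _; exact mul_nonneg (prob_nonneg _ _) (prob_nonneg _ _)

/-! ### Interlaced and nested sums -/

/-- `interTerm ≤ tau` (the box of the middle increment is contained in the large box). [folklore] -/
theorem interTerm_le_tau {i k j l : ℕ} : interTerm 4 i k j l ≤ tau (k - i) (j - k) (l - j) := by
  unfold interTerm tau
  refine Finset.sum_le_sum_of_subset_of_nonneg (box_mono 4 (by omega)) fun y _ _ => ?_
  have := prob_nonneg (d := 4) (k - i) y; have := prob_nonneg (d := 4) (j - k) y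
  have := prob_nonneg (d := 4) (l - j) y; positivity

/-- **The interlaced sum is `≤ n K₃`.** [folklore] -/
theorem sum_interlaced_le (n : ℕ) :
    ∑ p ∈ upperPairs n, ∑ p' ∈ upperPairs n,
      (if p.1 < p'.1 ∧ p'.1 < p.2 ∧ p.2 < p'.2 then interTerm 4 p.1 p'.1 p.2 p'.2 else 0) ≤ n * tauSumConst := by
  classical
  rw [sum_sum_upperPairs]
  have hK := fun L => sum_tau_le L
  calc ∑ q ∈ upperPairs n ×ˢ upperPairs n,
        (if q.1.1 < q.2.1 ∧ q.2.1 < q.1.2 ∧ q.1.2 < q.2.2 then interTerm 4 q.1.1 q.2.1 q.1.2 q.2.2 else 0)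
      ≤ ∑ r ∈ Finset.range n ×ˢ (Finset.Icc 1 (2 * n) ×ˢ (Finset.Icc 1 (2 * n) ×ˢ Finset.Icc 1 (2 * n))),
          tau r.2.1 r.2.2.1 r.2.2.2 := by
        refine sum_ite_le_sum_of_injOn _ _ _ _ _
          (fun q => (q.1.1, (q.2.1 - q.1.1, (q.1.2 - q.2.1, q.2.2 - q.1.2)))) ?_ ?_ ?_ ?_
        · intro q hq hP
          rw [Finset.mem_product, mem_upperPairs, mem_upperPairs] at hq
          simp only [Finset.mem_product, Finset.mem_range, Finset.mem_Icc]
          omega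
        · intro q hq r hr h
          simp only [Finset.coe_filter, Finset.mem_product, mem_upperPairs, Set.mem_setOf_eq] at hq hr
          simp only [Prod.mk.injEq] at h
          obtain ⟨⟨⟨_, _, _⟩, ⟨_, _, _⟩⟩, hP⟩ := hq
          obtain ⟨⟨⟨_, _, _⟩, ⟨_, _, _⟩⟩, hP'⟩ := hr
          ext <;> omega
        · intro q _ _; exact interTerm_le_tau
        · intro r _; exact tau_nonneg _ _ _
    _ = ∑ _i ∈ Finset.range n, ∑ a ∈ Finset.Icc 1 (2 * n), ∑ b ∈ Finset.Icc 1 (2 * n),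
          ∑ c ∈ Finset.Icc 1 (2 * n), tau a b c := by
        rw [Finset.sum_product]
        refine Finset.sum_congr rfl fun i _ => ?_
        rw [Finset.sum_product]
        refine Finset.sum_congr rfl fun a _ => ?_
        rw [Finset.sum_product]
    _ ≤ ∑ _i ∈ Finset.range n, tauSumConst := Finset.sum_le_sum fun i _ => hK (2 * n)
    _ = n * tauSumConst := by rw [Finset.sum_const, Finset.card_range, nsmul_eq_mul]

/-- **The nested sum is `≤ n K₄`.** [folklore] -/
theorem sum_nested_upper_le (n : ℕ) :
    ∑ p ∈ upperPairs n, ∑ p' ∈ upperPairs n,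
      (if p.1 < p'.1 ∧ p'.2 < p.2 then nestTerm 4 p.1 p'.1 p'.2 p.2 else 0) ≤ n * nestedSumConst := by
  classical
  rw [sum_sum_upperPairs]
  calc ∑ q ∈ upperPairs n ×ˢ upperPairs n,
        (if q.1.1 < q.2.1 ∧ q.2.2 < q.1.2 then nestTerm 4 q.1.1 q.2.1 q.2.2 q.1.2 else 0)
      ≤ ∑ r ∈ Finset.range n ×ˢ (Finset.Icc 1 (2 * n) ×ˢ (Finset.Icc 1 (2 * n) ×ˢ Finset.Icc 1 (2 * n))),
          prob 4 r.2.2.1 0 * (prob 4 (r.2.1 + r.2.2.2) 0 - prob 4 (r.2.1 + r.2.2.1 + r.2.2.2) 0) := by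
        refine sum_ite_le_sum_of_injOn _ _ _ _ _
          (fun q => (q.1.1, (q.2.1 - q.1.1, (q.2.2 - q.2.1, q.1.2 - q.2.2)))) ?_ ?_ ?_ ?_
        · intro q hq hP
          rw [Finset.mem_product, mem_upperPairs, mem_upperPairs] at hq
          simp only [Finset.mem_product, Finset.mem_range, Finset.mem_Icc]
          omega
        · intro q hq r hr h
          simp only [Finset.coe_filter, Finset.mem_product, mem_upperPairs, Set.mem_setOf_eq] at hq hr
          simp only [Prod.mk.injEq] at h
          obtain ⟨⟨⟨_, _, _⟩, ⟨_, _, _⟩⟩, hP⟩ := hq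
          obtain ⟨⟨⟨_, _, _⟩, ⟨_, _, _⟩⟩, hP'⟩ := hr
          ext <;> omega
        · intro q hq hP
          rw [Finset.mem_product, mem_upperPairs, mem_upperPairs] at hq
          unfold nestTerm
          simp only
          have h1 : q.2.1 - q.1.1 + (q.1.2 - q.2.2) = q.2.1 - q.1.1 + (q.1.2 - q.2.2) := rfl
          rw [show q.2.1 - q.1.1 + (q.2.2 - q.2.1) + (q.1.2 - q.2.2) = q.1.2 - q.1.1 by omega]
        · intro r _; exact nested_term_nonneg _ _ _
    _ = ∑ _i ∈ Finset.range n, ∑ a ∈ Finset.Icc 1 (2 * n), ∑ b ∈ Finset.Icc 1 (2 * n),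
          ∑ c ∈ Finset.Icc 1 (2 * n), prob 4 b 0 * (prob 4 (a + c) 0 - prob 4 (a + b + c) 0) := by
        rw [Finset.sum_product]
        refine Finset.sum_congr rfl fun i _ => ?_
        rw [Finset.sum_product]
        refine Finset.sum_congr rfl fun a _ => ?_
        rw [Finset.sum_product]
    _ ≤ ∑ _i ∈ Finset.range n, nestedSumConst := Finset.sum_le_sum fun i _ => sum_nested_le (2 * n)
    _ = n * nestedSumConst := by rw [Finset.sum_const, Finset.card_range, nsmul_eq_mul]

/-! ### The bounds -/

/-- The constant of the overlap sum, `G + 12 G²`. [folklore] -/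
def ovConst : ℝ := green4 + 12 * green4 ^ 2

/-- The constant of the variance sum, `G + 12 G² + 2K₃ + 2K₄`. [folklore] -/
def varConst : ℝ := ovConst + 2 * tauSumConst + 2 * nestedSumConst

/-- **`ovSum 4 n ≤ (G + 12 G²) n`.** [folklore] -/
theorem ovSum_four_le (n : ℕ) : ovSum 4 n ≤ ovConst * n := by
  have h := ovSum_le (d := 4) n
  have h0 := sum_pairProb_le n
  -- the six share-one sums
  have hA : ∑ p ∈ upperPairs n, ∑ p' ∈ upperPairs n,
      (if p.1 = p'.1 ∧ p.2 < p'.2 then prob 4 (p.2 - p.1) 0 * prob 4 (p'.2 - p.2) 0 else 0) ≤ 2 * n * green4 ^ 2 := by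
    refine shareOne_le n _ (fun p _ => p.1) (fun p _ => p.2 - p.1) (fun p p' => p'.2 - p.2) ?_ ?_
    · intro p hp p' hp' hP; rw [mem_upperPairs] at hp hp'; omega
    · intro p hp p' hp' q hq q' hq' hP hQ h1 h2 h3
      rw [mem_upperPairs] at hp hp' hq hq'
      refine ⟨Prod.ext h1 (by omega), Prod.ext (by omega) (by omega)⟩
  have hB : ∑ p ∈ upperPairs n, ∑ p' ∈ upperPairs n,
      (if p.1 = p'.1 ∧ p'.2 < p.2 then prob 4 (p'.2 - p.1) 0 * prob 4 (p.2 - p'.2) 0 else 0) ≤ 2 * n * green4 ^ 2 := by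
    refine shareOne_le n _ (fun p _ => p.1) (fun p p' => p'.2 - p.1) (fun p p' => p.2 - p'.2) ?_ ?_
    · intro p hp p' hp' hP; rw [mem_upperPairs] at hp hp'; omega
    · intro p hp p' hp' q hq q' hq' hP hQ h1 h2 h3
      rw [mem_upperPairs] at hp hp' hq hq'
      refine ⟨Prod.ext h1 (by omega), Prod.ext (by omega) (by omega)⟩
  have hC : ∑ p ∈ upperPairs n, ∑ p' ∈ upperPairs n,
      (if p.2 = p'.2 ∧ p.1 < p'.1 then prob 4 (p'.1 - p.1) 0 * prob 4 (p.2 - p'.1) 0 else 0) ≤ 2 * n * green4 ^ 2 := by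
    refine shareOne_le n _ (fun p _ => p.1) (fun p p' => p'.1 - p.1) (fun p p' => p.2 - p'.1) ?_ ?_
    · intro p hp p' hp' hP; rw [mem_upperPairs] at hp hp'; omega
    · intro p hp p' hp' q hq q' hq' hP hQ h1 h2 h3
      rw [mem_upperPairs] at hp hp' hq hq'
      refine ⟨Prod.ext h1 (by omega), Prod.ext (by omega) (by omega)⟩
  have hD : ∑ p ∈ upperPairs n, ∑ p' ∈ upperPairs n,
      (if p.2 = p'.2 ∧ p'.1 < p.1 then prob 4 (p.1 - p'.1) 0 * prob 4 (p.2 - p.1) 0 else 0) ≤ 2 * n * green4 ^ 2 := by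
    refine shareOne_le n _ (fun p p' => p'.1) (fun p p' => p.1 - p'.1) (fun p _ => p.2 - p.1) ?_ ?_
    · intro p hp p' hp' hP; rw [mem_upperPairs] at hp hp'; omega
    · intro p hp p' hp' q hq q' hq' hP hQ h1 h2 h3
      rw [mem_upperPairs] at hp hp' hq hq'
      refine ⟨Prod.ext (by omega) (by omega), Prod.ext h1 (by omega)⟩
  have hE : ∑ p ∈ upperPairs n, ∑ p' ∈ upperPairs n,
      (if p.2 = p'.1 then prob 4 (p.2 - p.1) 0 * prob 4 (p'.2 - p.2) 0 else 0) ≤ 2 * n * green4 ^ 2 := by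
    refine shareOne_le n _ (fun p _ => p.1) (fun p _ => p.2 - p.1) (fun p p' => p'.2 - p.2) ?_ ?_
    · intro p hp p' hp' hP; rw [mem_upperPairs] at hp hp'; omega
    · intro p hp p' hp' q hq q' hq' hP hQ h1 h2 h3
      rw [mem_upperPairs] at hp hp' hq hq'
      refine ⟨Prod.ext h1 (by omega), Prod.ext (by omega) (by omega)⟩
  have hF : ∑ p ∈ upperPairs n, ∑ p' ∈ upperPairs n,
      (if p.1 = p'.2 then prob 4 (p.1 - p'.1) 0 * prob 4 (p.2 - p.1) 0 else 0) ≤ 2 * n * green4 ^ 2 := by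
    refine shareOne_le n _ (fun p p' => p'.1) (fun p p' => p.1 - p'.1) (fun p _ => p.2 - p.1) ?_ ?_
    · intro p hp p' hp' hP; rw [mem_upperPairs] at hp hp'; omega
    · intro p hp p' hp' q hq q' hq' hP hQ h1 h2 h3
      rw [mem_upperPairs] at hp hp' hq hq'
      refine ⟨Prod.ext (by omega) (by omega), Prod.ext h1 (by omega)⟩
  have hsplit : ∑ p ∈ upperPairs n, ∑ p' ∈ upperPairs n,
      ((if p.1 = p'.1 ∧ p.2 < p'.2 then prob 4 (p.2 - p.1) 0 * prob 4 (p'.2 - p.2) 0 else 0) +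
       (if p.1 = p'.1 ∧ p'.2 < p.2 then prob 4 (p'.2 - p.1) 0 * prob 4 (p.2 - p'.2) 0 else 0) +
       (if p.2 = p'.2 ∧ p.1 < p'.1 then prob 4 (p'.1 - p.1) 0 * prob 4 (p.2 - p'.1) 0 else 0) +
       (if p.2 = p'.2 ∧ p'.1 < p.1 then prob 4 (p.1 - p'.1) 0 * prob 4 (p.2 - p.1) 0 else 0) +
       (if p.2 = p'.1 then prob 4 (p.2 - p.1) 0 * prob 4 (p'.2 - p.2) 0 else 0) +
       (if p.1 = p'.2 then prob 4 (p.1 - p'.1) 0 * prob 4 (p.2 - p.1) 0 else 0)) ≤ 6 * (2 * n * green4 ^ 2) := by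
    simp only [Finset.sum_add_distrib]
    linarith
  unfold ovConst
  nlinarith [green4_pos]

/-- **The variance of the number of self-intersections in a window is `O(n)` on `ℤ⁴`**:
`varSum 4 n ≤ (G + 12 G² + 2K₃ + 2K₄) n`. [folklore] -/
theorem varSum_four_le (n : ℕ) : varSum 4 n ≤ varConst * n := by
  have h := varSum_le (d := 4) n
  have hov := ovSum_four_le n
  have hI := sum_interlaced_le n
  have hN := sum_nested_upper_le n
  -- the primed (mirror) sums equal the unprimed ones by swapping the summation variables
  have hI' : ∑ p ∈ upperPairs n, ∑ p' ∈ upperPairs n,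
      (if p'.1 < p.1 ∧ p.1 < p'.2 ∧ p'.2 < p.2 then interTerm 4 p'.1 p.1 p'.2 p.2 else 0) ≤ n * tauSumConst := by
    rw [Finset.sum_comm]; exact hI
  have hN' : ∑ p ∈ upperPairs n, ∑ p' ∈ upperPairs n,
      (if p'.1 < p.1 ∧ p.2 < p'.2 then nestTerm 4 p'.1 p.1 p.2 p'.2 else 0) ≤ n * nestedSumConst := by
    rw [Finset.sum_comm]; exact hN
  have hsumI : ∑ p ∈ upperPairs n, ∑ p' ∈ upperPairs n,
      ((if p.1 < p'.1 ∧ p'.1 < p.2 ∧ p.2 < p'.2 then interTerm 4 p.1 p'.1 p.2 p'.2 else 0) +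
        (if p'.1 < p.1 ∧ p.1 < p'.2 ∧ p'.2 < p.2 then interTerm 4 p'.1 p.1 p'.2 p.2 else 0)) ≤ 2 * (n * tauSumConst) := by
    simp only [Finset.sum_add_distrib]; linarith
  have hsumN : ∑ p ∈ upperPairs n, ∑ p' ∈ upperPairs n,
      ((if p.1 < p'.1 ∧ p'.2 < p.2 then nestTerm 4 p.1 p'.1 p'.2 p.2 else 0) +
        (if p'.1 < p.1 ∧ p.2 < p'.2 then nestTerm 4 p'.1 p.1 p.2 p'.2 else 0)) ≤ 2 * (n * nestedSumConst) := by
    simp only [Finset.sum_add_distrib]; linarith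
  unfold varConst
  linarith

end SRW

end Literature.Probability.LatticeModels
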